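import Literature.Computability.AlgebraicComplexity.LaserFormatWordSplit
import HarnessLib

/-!
# One valued label word gives the laser bound for its type (format currency)

Topic `Literature/Computability/AlgebraicComplexity`.  The word-value form of the rectangular
laser method, `laserMethod_hasFormatValue_of_blockValue` (Le Gall 2014 Thm. 4.1 / Le Gall 2012
§3–§4 in the tree's `HasFormatValue` currency), asks for a format value of EVERY block
`t^{⊗dM}(w)` whose label word `w` has type `M·c`.  In two-stage analyses (Coppersmith–Winograd 1990
§8, Le Gall 2012 §6: the positions of a block of `(CW_q^{⊗2})^{⊗N}` carrying matrix-product
letters are valued one by one, the positions carrying the letters `[112]`, `[121]`, `[211]` are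
valued JOINTLY) such a value is naturally produced for ONE word `w : Fin d → I×J×L` — a
concatenation of constant runs and of a jointly valued family word.  This file closes the gap:

* `repWord w M` — the `M`-fold (`d`-periodic) repetition of `w`, a word of length `dM` of type
  `M · letterCount w` (`letterCount_repWord`), whose block is a relabelling of the `M`-th Kronecker
  power of the block of `w` (`tensorRestrictsTo_laserBlock_repWord`,
  `HasFormatValue.laserBlock_repWord`);
* `laserMethod_hasFormatValue_of_wordValue` — **if the block of one word `w` of length `d` (letters
  in the tight support `S`) is worth `W^d` products of format `(A^d, B^d, C^d)`, then `t` is worth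
  `2^{min_m H(P_m) − Γ_S(P)} · W` products of format `(A,B,C)` for the empirical law
  `P = letterCount w / d`** (blocks of equal type are relabellings of each other,
  `HasFormatValue.laserBlock_of_letterCount_eq`, so the hypothesis `hW` of the word-value theorem
  holds for every word of type `M · letterCount w`);
* builders for valued words: `tensorRestrictsTo_laserBlock_one`, `tensorRestrictsTo_laserBlock_append`,
  `HasFormatValue.laserBlock_const`, `HasFormatValue.laserBlock_of_kronecker`;
* the readings `omegaRect_one_mid_one_le_two_of_hasFormatValue` (`R̃(t) ≤ v A²` with
  `HasFormatValue t v A B A`, `A^k ≤ B` gives `ω(1,k,1) ≤ 2`: the saturated case of Le Gall 2012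
  Thm. 2.1, used for the `α`-designs) and `omegaRect_one_mid_one_le_of_wordValue`.

Library fit: proofs only (`laserMethod_hasFormatValue_of_blockValue`, `LaserFormatWordSplit`,
`HasFormatValue.kroneckerPow`, `tensorRestrictsTo_precomp`); one auxiliary definition (`repWord`);
no named facts.  (Searched: `laserBlock`, `letterCount`, `repWord`, `periodic word`,
`hasFormatValue_laserBlock` — the tree values blocks positionwise (`laserMethod_hasFormatValue_of_counts`)
or along ONE concatenation per type (`hasFormatValue_laserBlock_of_append`), but had no passage from a
single valued word to the hypothesis `hW` for all multiples of its type.)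

## References

* D. Coppersmith, S. Winograd, *Matrix multiplication via arithmetic progressions*,
  J. Symbolic Comput. 9 (1990), §8. [CoppersmithWinograd1990]
* F. Le Gall, *Faster algorithms for rectangular matrix multiplication*, FOCS 2012,
  arXiv:1204.1111, Thm. 2.1, §3–§4, §6.1. [LeGall2012]
* F. Le Gall, *Powers of tensors and fast matrix multiplication*, ISSAC 2014, arXiv:1401.7714,
  Thm. 4.1 and Appendix A.3. [LeGall2014]
-/

set_option autoImplicit false
set_option linter.style.longLine false
set_option linter.unusedSectionVars false
set_option linter.unusedVariables false

noncomputable section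

open Finset
open scoped BigOperators

universe u

namespace Literature.Computability.AlgebraicComplexity

open Literature.Barriers.MatrixMultiplication

/-! ## Repeated words -/

section RepWord

variable {α : Type} [DecidableEq α]

/-- **The `M`-fold repetition of a word** `w : Fin d → α`, read `d`-periodically through
`finProdFinEquiv : Fin d × Fin M ≃ Fin (d M)`: position `ρ ↔ (i, j)` carries the letter `w i`.
[cite: LeGall2014, Appendix A.3] -/
def repWord {d : ℕ} (w : Fin d → α) (M : ℕ) : Fin (d * M) → α :=
  fun ρ => w (finProdFinEquiv.symm ρ).1

/-- Unfolding of `repWord`. [cite: LeGall2014, Appendix A.3] -/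
theorem repWord_apply {d : ℕ} (w : Fin d → α) (M : ℕ) (ρ : Fin (d * M)) :
    repWord w M ρ = w (finProdFinEquiv.symm ρ).1 := rfl

/-- **The repetition has type `M · letterCount w`.** [cite: LeGall2014, Appendix A.3] -/
theorem letterCount_repWord {d : ℕ} (w : Fin d → α) (M : ℕ) :
    letterCount (repWord w M) = fun s => M * letterCount w s := by
  funext s
  simp only [letterCount_apply, Finset.card_filter, repWord]
  rw [← Equiv.sum_comp finProdFinEquiv
    (fun ρ : Fin (d * M) => if w (finProdFinEquiv.symm ρ).1 = s then 1 else 0)]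
  simp only [Equiv.symm_apply_apply, Fintype.sum_prod_type]
  rw [Finset.mul_sum]
  refine Finset.sum_congr rfl fun i _ => ?_
  split_ifs <;> simp

end RepWord

/-! ## Blocks of repeated and concatenated words -/

section Blocks

variable {K : Type u} [Field K]
variable {ι κ μ : Type} [Fintype ι] [Fintype κ] [Fintype μ] [DecidableEq ι] [DecidableEq κ]
  [DecidableEq μ]
variable {I J L : Type} [DecidableEq I] [DecidableEq J] [DecidableEq L]

/-- **The block of the repeated word contains the power of the block**:
`t^{⊗dM}(repWord w M) ≥ (t^{⊗d}(w))^{⊗M}` — indeed the two are isomorphic, by regrouping the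
positions `ρ ↔ (i,j)` (`∏_ρ = ∏_j ∏_i`). [cite: LeGall2014, Appendix A.3] -/
theorem tensorRestrictsTo_laserBlock_repWord (bI : ι → I) (bJ : κ → J) (bL : μ → L)
    (t : ι → κ → μ → K) {d : ℕ} (w : Fin d → I × J × L) (M : ℕ) :
    TensorRestrictsTo (laserBlock bI bJ bL t (repWord w M))
      (kroneckerPow (laserBlock bI bJ bL t w) M) := by
  have key : kroneckerPow (laserBlock bI bJ bL t w) M = fun a b c =>
      laserBlock bI bJ bL t (repWord w M)
        (fun ρ => a (finProdFinEquiv.symm ρ).2 (finProdFinEquiv.symm ρ).1)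
        (fun ρ => b (finProdFinEquiv.symm ρ).2 (finProdFinEquiv.symm ρ).1)
        (fun ρ => c (finProdFinEquiv.symm ρ).2 (finProdFinEquiv.symm ρ).1) := by
    funext a b c
    simp only [kroneckerPow_apply, laserBlock, kroneckerPi_apply, repWord]
    rw [← Equiv.prod_comp finProdFinEquiv (fun ρ : Fin (d * M) =>
      partSubtensor bI bJ bL t {(w (finProdFinEquiv.symm ρ).1).1}
        {(w (finProdFinEquiv.symm ρ).1).2.1} {(w (finProdFinEquiv.symm ρ).1).2.2}
        (a (finProdFinEquiv.symm ρ).2 (finProdFinEquiv.symm ρ).1)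
        (b (finProdFinEquiv.symm ρ).2 (finProdFinEquiv.symm ρ).1)
        (c (finProdFinEquiv.symm ρ).2 (finProdFinEquiv.symm ρ).1))]
    simp only [Equiv.symm_apply_apply, Fintype.prod_prod_type]
    exact Finset.prod_comm
  rw [key]
  exact tensorRestrictsTo_precomp _ _ _ _

/-- Hence a format value of the block of `w` gives one of the block of `repWord w M`
(parameters `≥ 0`): `(v^M; A^M, B^M, C^M)`. [cite: LeGall2014, Appendix A.3 and §2.2] -/
theorem HasFormatValue.laserBlock_repWord (bI : ι → I) (bJ : κ → J) (bL : μ → L)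
    (t : ι → κ → μ → K) {d : ℕ} {w : Fin d → I × J × L} {v A B C : ℝ}
    (h : HasFormatValue (laserBlock bI bJ bL t w) v A B C) (hv : 0 ≤ v) (hA : 0 ≤ A) (hB : 0 ≤ B)
    (hC : 0 ≤ C) (M : ℕ) :
    HasFormatValue (laserBlock bI bJ bL t (repWord w M)) (v ^ M) (A ^ M) (B ^ M) (C ^ M) :=
  (h.kroneckerPow hv hA hB hC M).of_restrictsTo (tensorRestrictsTo_laserBlock_repWord bI bJ bL t w M)

/-- **The block of a one-letter word is the component**: `t^{⊗1}((s)) ≥ t(s)` (the two are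
isomorphic). [cite: LeGall2014, Appendix A.3] -/
theorem tensorRestrictsTo_laserBlock_one (bI : ι → I) (bJ : κ → J) (bL : μ → L)
    (t : ι → κ → μ → K) (s : I × J × L) :
    TensorRestrictsTo (laserBlock bI bJ bL t (fun _ : Fin 1 => s))
      (partSubtensor bI bJ bL t {s.1} {s.2.1} {s.2.2}) := by
  have key : partSubtensor bI bJ bL t {s.1} {s.2.1} {s.2.2} = fun a b c =>
      laserBlock bI bJ bL t (fun _ : Fin 1 => s) (fun _ => a) (fun _ => b) (fun _ => c) := by
    funext a b c
    simp only [laserBlock, kroneckerPi_apply, Fin.prod_univ_one]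
  rw [key]
  exact tensorRestrictsTo_precomp _ _ _ _

/-- **The block of a concatenated word contains the Kronecker product of the two blocks**
(`laserBlock_append`, `tensorRestrictsTo_kroneckerPi_append`). [cite: LeGall2014, Appendix A.3] -/
theorem tensorRestrictsTo_laserBlock_append (bI : ι → I) (bJ : κ → J) (bL : μ → L)
    (t : ι → κ → μ → K) {m n : ℕ} (w : Fin m → I × J × L) (w' : Fin n → I × J × L) :
    TensorRestrictsTo (laserBlock bI bJ bL t (Fin.append w w'))
      (kroneckerTensor (laserBlock bI bJ bL t w) (laserBlock bI bJ bL t w')) := by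
  rw [Literature.Computability.AlgebraicComplexity.laserBlock_append]
  exact tensorRestrictsTo_kroneckerPi_append _ _

/-- A format value of `t^{⊗m}(w) ⊗ t^{⊗n}(w')` (e.g. from a JOINT extraction over the positions of
both words) is a format value of the block of `w ++ w'`. [cite: LeGall2012, §6.1]
[cite: LeGall2014, Appendix A.3] -/
theorem HasFormatValue.laserBlock_of_kronecker (bI : ι → I) (bJ : κ → J) (bL : μ → L)
    (t : ι → κ → μ → K) {m n : ℕ} {w : Fin m → I × J × L} {w' : Fin n → I × J × L}
    {v A B C : ℝ}
    (h : HasFormatValue (kroneckerTensor (laserBlock bI bJ bL t w) (laserBlock bI bJ bL t w'))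
      v A B C) :
    HasFormatValue (laserBlock bI bJ bL t (Fin.append w w')) v A B C :=
  h.of_restrictsTo (tensorRestrictsTo_laserBlock_append bI bJ bL t w w')

/-- **The block of a constant run** `(s, …, s)` of length `n` is `t(s)^{⊗n}`; a format value
`(v; A, B, C)` of the component (parameters `≥ 0`) gives `(v^n; A^n, B^n, C^n)` for the block.
[cite: LeGall2014, §2.2 and Appendix A.3] -/
theorem HasFormatValue.laserBlock_const (bI : ι → I) (bJ : κ → J) (bL : μ → L)
    (t : ι → κ → μ → K) {s : I × J × L} {v A B C : ℝ}
    (h : HasFormatValue (partSubtensor bI bJ bL t {s.1} {s.2.1} {s.2.2}) v A B C) (hv : 0 ≤ v)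
    (hA : 0 ≤ A) (hB : 0 ≤ B) (hC : 0 ≤ C) (n : ℕ) :
    HasFormatValue (laserBlock bI bJ bL t (fun _ : Fin n => s)) (v ^ n) (A ^ n) (B ^ n) (C ^ n) := by
  rw [show laserBlock bI bJ bL t (fun _ : Fin n => s) =
    Literature.Computability.AlgebraicComplexity.kroneckerPow
      (partSubtensor bI bJ bL t {s.1} {s.2.1} {s.2.2}) n from rfl]
  exact h.kroneckerPow hv hA hB hC n

/-- A format value of a tensor `T` below the component, `t(s) ≥ T` (e.g. a zero-out of the
component), gives the same value for the block of the one-letter word `(s)`.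
[cite: LeGall2014, Appendix A.3] -/
theorem HasFormatValue.laserBlock_one_of_restrictsTo (bI : ι → I) (bJ : κ → J) (bL : μ → L)
    (t : ι → κ → μ → K) {s : I × J × L} {ι' κ' μ' : Type} [Fintype ι'] [Fintype κ'] [Fintype μ']
    [DecidableEq ι'] [DecidableEq κ'] [DecidableEq μ'] {T : ι' → κ' → μ' → K} {v A B C : ℝ}
    (hT : TensorRestrictsTo (partSubtensor bI bJ bL t {s.1} {s.2.1} {s.2.2}) T)
    (h : HasFormatValue T v A B C) :
    HasFormatValue (laserBlock bI bJ bL t (fun _ : Fin 1 => s)) v A B C :=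
  h.of_restrictsTo ((tensorRestrictsTo_laserBlock_one bI bJ bL t s).trans hT)

end Blocks

/-! ## The laser bound from one valued word -/

section WordValue

variable {K : Type u} [Field K]
variable {ι κ μ : Type} [Fintype ι] [Fintype κ] [Fintype μ] [DecidableEq ι] [DecidableEq κ]
  [DecidableEq μ]
variable {I J L : Type} [Fintype I] [Fintype J] [Fintype L] [DecidableEq I] [DecidableEq J]
  [DecidableEq L]

omit [Fintype I] [Fintype J] [Fintype L] in
/-- A word with all letters in `S` has type supported in `S`. [cite: LeGall2014, Appendix A.3] -/
theorem letterCount_eq_zero_of_forall_mem {S : Finset (I × J × L)} {d : ℕ} {w : Fin d → I × J × L}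
    (hw : ∀ ρ, w ρ ∈ S) (s : I × J × L) (hs : s ∉ S) : letterCount w s = 0 := by
  rw [letterCount_apply, Finset.card_eq_zero, Finset.filter_eq_empty_iff]
  intro ρ _ h
  exact hs (h ▸ hw ρ)

/-- **The laser bound from ONE valued word** (Le Gall 2014 Thm. 4.1 / Le Gall 2012 §3–§4 and
§6.1, format currency).  Let `t` be partitioned with tight support `S`, and let `w : Fin d → S`
(`d > 0`) be a label word whose block `t^{⊗d}(w)` is worth `W^d` products of format
`(A^d, B^d, C^d)` (`W > 0`; `A, B, C ≥ 0`).  Then, for the empirical law `P = letterCount w / d`,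
`t` is worth `2^{min_m H(P_m) − Γ_S(P)} · W` products of format `(A, B, C)`.
Proof: every block of type `M · letterCount w` is a relabelling of the block of `repWord w M`
(`HasFormatValue.laserBlock_of_letterCount_eq`), which contains `(t^{⊗d}(w))^{⊗M}`
(`HasFormatValue.laserBlock_repWord`); this is hypothesis `hW` of
`laserMethod_hasFormatValue_of_blockValue`. [cite: LeGall2014, Thm. 4.1 and Appendix A.3]
[cite: LeGall2012, §3 and §6.1] [cite: CoppersmithWinograd1990, §8] -/
theorem laserMethod_hasFormatValue_of_wordValue (t : ι → κ → μ → K) (bI : ι → I) (bJ : κ → J)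
    (bL : μ → L) (S : Finset (I × J × L)) (hS : ∀ a b c, t a b c ≠ 0 → (bI a, bJ b, bL c) ∈ S)
    {r b : ℕ} (α : I → Fin r → ℤ) (β : J → Fin r → ℤ) (γ : L → Fin r → ℤ)
    (hα : Function.Injective α) (hβ : Function.Injective β) (hγ : Function.Injective γ)
    (hαb : ∀ i k, |α i k| ≤ b) (hβb : ∀ j k, |β j k| ≤ b)
    (htight : ∀ s ∈ S, ∀ k, α s.1 k + β s.2.1 k + γ s.2.2 k = 0)
    {d : ℕ} (hd : 0 < d) (w : Fin d → I × J × L) (hw : ∀ ρ, w ρ ∈ S)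
    (P : I × J × L → ℝ) (hP : ∀ s, P s = (letterCount w s : ℝ) / d)
    {W A B C : ℝ} (hW0 : 0 < W) (hA : 0 ≤ A) (hB : 0 ≤ B) (hC : 0 ≤ C)
    (hW : HasFormatValue (laserBlock bI bJ bL t w) (W ^ d) (A ^ d) (B ^ d) (C ^ d)) :
    HasFormatValue t ((2 : ℝ) ^ (min (shannonEntropy (marginalDist₁ P))
        (min (shannonEntropy (marginalDist₂ P)) (shannonEntropy (marginalDist₃ P))) -
        maxEntropyPenalty S P) * W) A B C := by
  refine laserMethod_hasFormatValue_of_blockValue t bI bJ bL S hS α β γ hα hβ hγ hαb hβb htight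
    (letterCount w) (letterCount_eq_zero_of_forall_mem hw) hd (sum_letterCount w) P hP hW0 hA hB
    hC fun M hM u hu => ?_
  have h1 := hW.laserBlock_repWord bI bJ bL t (pow_nonneg hW0.le d) (pow_nonneg hA d)
    (pow_nonneg hB d) (pow_nonneg hC d) M
  rw [← pow_mul, ← pow_mul, ← pow_mul, ← pow_mul] at h1
  refine h1.laserBlock_of_letterCount_eq bI bJ bL t ?_
  rw [letterCount_repWord, hu]

end WordValue

/-! ## Readings -/

section Omega

variable {K : Type} [Field K]
variable {ι κ μ : Type} [Fintype ι] [Fintype κ] [Fintype μ] [DecidableEq ι] [DecidableEq κ]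
  [DecidableEq μ]
variable {I J L : Type} [Fintype I] [Fintype J] [Fintype L] [DecidableEq I] [DecidableEq J]
  [DecidableEq L]

/-- **The saturated reading** (Le Gall 2012 Thm. 2.1, the case of equality in the packing bound):
if `HasFormatValue t v A B A` with `1 < A`, `0 ≤ k`, `A^k ≤ B`, `0 < v` and `R̃(t) ≤ v A²`, then
`ω(1,k,1) ≤ 2` (`v A^{ω(1,k,1)} ≤ R̃(t) ≤ v A²` by
`mul_rpow_omegaRect_le_asymptoticRank_of_hasFormatValue`). [cite: LeGall2012, Thm. 2.1]
[cite: Coppersmith1997, §3] -/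
theorem omegaRect_one_mid_one_le_two_of_hasFormatValue {t : ι → κ → μ → K} {v A B k : ℝ}
    (h : HasFormatValue t v A B A) (hA : 1 < A) (hk : 0 ≤ k) (hAB : A ^ k ≤ B) (hv : 0 < v)
    (hsat : asymptoticRank t ≤ v * A ^ (2 : ℝ)) : omegaRect K 1 k 1 ≤ 2 := by
  have hmain := (mul_rpow_omegaRect_le_asymptoticRank_of_hasFormatValue h hA hk hAB).trans hsat
  have hA0 : 0 < A := by linarith
  have h1 : A ^ omegaRect K 1 k 1 ≤ A ^ (2 : ℝ) := le_of_mul_le_mul_left hmain hv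
  exact (Real.rpow_le_rpow_left_iff hA).1 h1

/-- **Corollary: the bound on `ω(1,k,1)` from one valued word.**  In the setting of
`laserMethod_hasFormatValue_of_wordValue` with outer formats `(A^d, B^d, A^d)`, `1 < A`, `0 ≤ k`,
`A^k ≤ B` and `R̃(t) ≤ R`: `ω(1,k,1) ≤ log(R/V)/log A` with `V = 2^{min_m H(P_m) − Γ_S(P)} W`.
[cite: LeGall2012, Thm. 2.1, §3 and §6.1] [cite: LeGall2014, Thm. 4.1] -/
theorem omegaRect_one_mid_one_le_of_wordValue (t : ι → κ → μ → K) (bI : ι → I) (bJ : κ → J)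
    (bL : μ → L) (S : Finset (I × J × L)) (hS : ∀ a b c, t a b c ≠ 0 → (bI a, bJ b, bL c) ∈ S)
    {r b : ℕ} (α : I → Fin r → ℤ) (β : J → Fin r → ℤ) (γ : L → Fin r → ℤ)
    (hα : Function.Injective α) (hβ : Function.Injective β) (hγ : Function.Injective γ)
    (hαb : ∀ i k, |α i k| ≤ b) (hβb : ∀ j k, |β j k| ≤ b)
    (htight : ∀ s ∈ S, ∀ k, α s.1 k + β s.2.1 k + γ s.2.2 k = 0)
    {d : ℕ} (hd : 0 < d) (w : Fin d → I × J × L) (hw : ∀ ρ, w ρ ∈ S)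
    (P : I × J × L → ℝ) (hP : ∀ s, P s = (letterCount w s : ℝ) / d)
    {W A B : ℝ} (hW0 : 0 < W) (hA1 : 1 < A) (hB : 0 ≤ B)
    (hW : HasFormatValue (laserBlock bI bJ bL t w) (W ^ d) (A ^ d) (B ^ d) (A ^ d))
    {k R : ℝ} (hk : 0 ≤ k) (hR : asymptoticRank t ≤ R) (hAB : A ^ k ≤ B) :
    omegaRect K 1 k 1 ≤ Real.log (R / ((2 : ℝ) ^ (min (shannonEntropy (marginalDist₁ P))
        (min (shannonEntropy (marginalDist₂ P)) (shannonEntropy (marginalDist₃ P))) -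
        maxEntropyPenalty S P) * W)) / Real.log A := by
  have hA : 0 ≤ A := by linarith
  have h := laserMethod_hasFormatValue_of_wordValue t bI bJ bL S hS α β γ hα hβ hγ hαb hβb htight
    hd w hw P hP hW0 hA hB hA hW
  exact omegaRect_one_mid_one_le_of_hasFormatValue h hA1 hk hAB
    (mul_pos (Real.rpow_pos_of_pos two_pos _) hW0) hR

end Omega

end Literature.Computability.AlgebraicComplexity

end
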